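import Summits.BirchSwinnertonDyer.BirchSwinnertonDyer.Theses.PrintCFram
import Summits.BirchSwinnertonDyer.Rank1Residual.PrintCfram.RegimeSplitThree
import Summits.BirchSwinnertonDyer.Rank1Residual.PrintCfram.TorsionFreeFrameThree
import Summits.BirchSwinnertonDyer.Rank1Residual.X12.O11.RamifiedEllipticUnitMechanismZpThree
import HarnessLib

/-! # The `zpthree` split of crux C1 `PrintCFram.CMRamifiedThreeBSD` (stmt-BirchSwinnertonDyer-20371), sorry-free part

The CONTENT decomposition of the @3 conjunct of route `PrintCFram` along ty2's `ℤ₃`-carriers at the ramified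
prime `3` (`X12/O11/RamifiedEllipticUnitMechanismZpThree.lean`), with all four inputs = ROUTE ITEMS BY NAME (rev 14):

  `CMRamifiedThreeBSD ⟸ EllipticUnitIMCThree ∧ BottomClassIndexLawThree ∧ LocalThreeTorsionBSDThree ∧ SplitPlaceTorsionBSDThree`

* `EllipticUnitIMCThree` (item stmt-BirchSwinnertonDyer-21353, crux r5) — (IMC)₃ᴺ;
* `BottomClassIndexLawThree` (item stmt-BirchSwinnertonDyer-21352, crux r4) — (PR|IMC)₃ᴺ under GZK;
* `LocalThreeTorsionBSDThree` (item T, stmt-BirchSwinnertonDyer-20699);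
* `SplitPlaceTorsionBSDThree` (item V, stmt-BirchSwinnertonDyer-20700).

The two Iwasawa items give child N `TorsionFreeFrameBSDThree` (stmt-BirchSwinnertonDyer-20698) through the seam
`X12.O11.ramifiedCMEllipticUnitIndexAtThree_of_imcZpThree_of_indexLawZpThree` (⟹ (R-EU)₃ member-wise) and ty2's
N-edge `Rank1Residual.PrintCfram.torsionFreeFrameBSDThree_of_indexLawAtThree`; the landed glue
`Rank1Residual.PrintCfram.cmRamifiedThreeBSD_of_regimes` assembles C1 from N, T, V. Neither Iwasawa item gives N
(let alone C1 or the leaf) alone: (IMC)₃ᴺ is independent of BSD, and (PR|IMC)₃ᴺ is relative to the IMC exponent.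
This file is the sorry-free part of the planner's registered skeleton `Cruxes/CMRamifiedThreeBSD/Lines/zpthree.lean`
(v2); it proves nothing about the four items themselves. -/

namespace Summit.BirchSwinnertonDyer.Rank1Residual.PrintCfram

open Summit.BirchSwinnertonDyer.BirchSwinnertonDyer.Theses.PrintCFram
open Summit.BirchSwinnertonDyer.Rank1Residual Summit.BirchSwinnertonDyer.Rank1Residual.X12.O11
open Literature Literature.NumberTheory.EllipticCurves Literature.NumberTheory.EllipticCurves.Rank1Residual
open IsDedekindDomain NumberField WeierstrassCurve

/-- (IMC)₃ᴺ ∧ (PR|IMC)₃ᴺ ⟹ child N `TorsionFreeFrameBSDThree` (BY NAME): the seam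
`ramifiedCMEllipticUnitIndexAtThree_of_imcZpThree_of_indexLawZpThree` gives (R-EU)₃ at every member (GZK taken from
N's own antecedent), and ty2's N-edge `torsionFreeFrameBSDThree_of_indexLawAtThree` turns the class-wide (R-EU)₃ law
into the route declaration N. -/
theorem torsionFreeFrameBSDThree_of_imcThree_of_indexLawThree
    (h1 : EllipticUnitIMCThree) (h2 : BottomClassIndexLawThree) : TorsionFreeFrameBSDThree := by
  intro hmod hGZ hGZK hCassels
  exact torsionFreeFrameBSDThree_of_indexLawAtThree
    (fun W _ _ hCM hr hram =>
      ramifiedCMEllipticUnitIndexAtThree_of_imcZpThree_of_indexLawZpThree (h1 W hCM hram hr) (h2 hGZK W hCM hram hr))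
    hmod hGZ hGZK hCassels

/-- The crux C1 `CMRamifiedThreeBSD` BY NAME from the four route items: (IMC)₃ᴺ + (PR|IMC)₃ᴺ give child N through
`torsionFreeFrameBSDThree_of_imcThree_of_indexLawThree`; T and V are the other two regime children; the landed glue
`cmRamifiedThreeBSD_of_regimes` assembles C1. -/
theorem cmRamifiedThreeBSD_of_zpThree : EllipticUnitIMCThree → BottomClassIndexLawThree →
    LocalThreeTorsionBSDThree → SplitPlaceTorsionBSDThree → CMRamifiedThreeBSD :=
  fun h1 h2 h3 h4 => cmRamifiedThreeBSD_of_regimes (torsionFreeFrameBSDThree_of_imcThree_of_indexLawThree h1 h2) h3 h4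

end Summit.BirchSwinnertonDyer.Rank1Residual.PrintCfram
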